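import Summits.QuantumAdvantage.QuantumAdvantage.Theorems.CharDialBlockDialD
import HarnessLib

/-!
# The block dial, part E: ★★★ `blockDial_hard` and `alignedBlock_hard` (decomp-qadv lens-6 g17 «OrbitDial», tree part 30Q)

THE BLOCK DIAL: for `p % 3 ≠ 0` there are `θ < 1` and `N₁` such that every junta ⊕ linear-form strategy with juntas `≤ L` whose forms mod `p` are
CONSTANT ON EACH of `M ≥ 2^p·(N₁+1)`, `M ≥ 2^p·((L+1)²+1)` separated `p`-blocks (arbitrary elsewhere, arbitrary tables) wins the mod-3 walk game on at
most `θ·2ⁿ` inputs (`blockDial_hard` = tiling `sum_card_Bset` + piece engine `blockPiece_hard` via `card_Bset_win_le` + tail `card_few_const_le_half`);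
in the summit's format (aligned blocks `{kp,…,kp+p−1}`, juntas `≤ log₂ n`, `a_g i` any function of `⌊i/p⌋`, all `n ≥ n₀`): `alignedBlock_hard`.
W-AWARE: along a piece the weight moves by multiples of `p`; decides block-level forms of rank up to `n/p` with full supports.
Supports item stmt-QuantumAdvantage-32604 (`CharDial.WalkHardFJLinOdd`); source: pub annex g17/OrbitDial37.lean §37q REV12 (sha256 7a2cb935…), namespace `…Theses.OrbitDial.BlockDial`, statements and proofs verbatim with the Prop abbreviations `InBlk`/`IsConst`/`BlkSep` INLINED (Prop-free twin).
-/

set_option autoImplicit false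

namespace Summit.QuantumAdvantage.AdviceFreeQNC0.JLinPeel.BlockDial

open Finset
open Summit.QuantumAdvantage.AdviceFreeQNC0
open Literature.Computability.MetaComplexity Literature.Computability.MetaComplexity.Smolensky

section BlockTail
open Classical
variable {n M : ℕ} {p : ℕ} {S : Fin M → ℕ}

/-! #### ★★★ THE BLOCK DIAL: junta ⊕ forms constant on many separated `p`-blocks are HARD -/

/-- ★★★ **THE BLOCK DIAL `blockDial_hard`.**  For `p ≢ 0 (mod 3)` there are `θ < 1` and `N₁` such that: whenever `M ≥ 2^p·(N₁+1)` and
`M ≥ 2^p·((L+1)²+1)` pairwise separated `p`-blocks fit into `{0,…,n−1}`, every junta ⊕ linear-form strategy with juntas of size `≤ L` whose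
forms are CONSTANT ON EACH BLOCK (arbitrary elsewhere, arbitrary tables) wins the mod-3 walk game with shift `c` on at most `θ·2ⁿ` inputs.
Proof = tiling of the cube by the pieces «re-set the constant blocks of `u`» (`sum_card_Bset`), the piece engine `blockPiece_hard`
transported to each piece with `≥ max(N₁,(L+1)²)+1` free blocks (`card_Bset_win_le`), and the constant-block tail (`card_few_const_le_half`).
W-AWARE: along a piece the weight `W` moves by multiples of `p` — the forms are frozen, the walk is not. -/
theorem blockDial_hard (p : ℕ) (hp3 : p % 3 = 1 ∨ p % 3 = 2) :
    ∃ θ : ℝ, θ < 1 ∧ ∃ N₁ : ℕ, ∀ (n M L : ℕ) (S : Fin M → ℕ), ((∀ k k', k < k' → S k + p ≤ S k') ∧ (∀ k, S k + p ≤ n)) →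
      2 ^ p * (N₁ + 1) ≤ M → 2 ^ p * ((L + 1) * (L + 1) + 1) ≤ M →
      ∀ (c : ℕ) (D : JLinPeel.JLinData p n), (∀ g, (D.J g).card ≤ L) →
        (∀ g (k : Fin M) (i i' : Fin n), (S k ≤ i.val ∧ i.val < S k + p) → (S k ≤ i'.val ∧ i'.val < S k + p) → D.a g i = D.a g i') →
        ((univ.filter fun u : Fin n → Bool => ringWinU c D.strat u = true).card : ℝ) ≤ θ * (2 : ℝ) ^ n := by
  obtain ⟨θ, hθ, N₀, hpiece⟩ := blockPiece_hard p hp3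
  refine ⟨(1 + θ) / 2, by linarith, N₀, ?_⟩
  intro n M L S h hM₁ hM₂ c D hJ hconst
  have hp1 : 1 ≤ p := by omega
  set T : ℕ := max N₀ ((L + 1) * (L + 1)) with hT
  have hMT : 2 ^ p * (T + 1) ≤ M := by
    rcases le_total N₀ ((L + 1) * (L + 1)) with hle | hle
    · rw [hT, max_eq_right hle]; exact hM₂
    · rw [hT, max_eq_left hle]; exact hM₁
  have hTN : N₀ ≤ T := le_max_left _ _
  have hTL : (L + 1) * (L + 1) ≤ T := le_max_right _ _
  have htile := sum_card_Bset h hp1 (fun u : Fin n → Bool => ringWinU c D.strat u = true)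
  have hbad_le := card_few_const_le_half h hp1 T hMT
  have hper : ∀ u : Fin n → Bool,
      ((univ.filter fun w : Fin M → Bool => ringWinU c D.strat (Bset p S u w) = true).card : ℝ)
        ≤ (if (cblk p S u).card ≤ T then (2 : ℝ) ^ M else θ * (2 : ℝ) ^ M) := by
    intro u
    by_cases hu : (cblk p S u).card ≤ T
    · rw [if_pos hu]
      have hle : (univ.filter fun w : Fin M → Bool => ringWinU c D.strat (Bset p S u w) = true).card ≤ 2 ^ M := by
        calc _ ≤ (univ : Finset (Fin M → Bool)).card := card_le_card (filter_subset _ _)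
          _ = 2 ^ M := by rw [card_univ, Fintype.card_fun, Fintype.card_bool, Fintype.card_fin]
      exact_mod_cast hle
    · rw [if_neg hu]
      exact card_Bset_win_le h c D (fun N s hs hN hL' hc' => hpiece n N s hs hN L hL' c D hJ hc') hconst u
        (by omega) (by omega)
  have hsum : (((2 ^ M * (univ.filter fun u : Fin n → Bool => ringWinU c D.strat u = true).card : ℕ)) : ℝ)
      ≤ ∑ u : Fin n → Bool, (if (cblk p S u).card ≤ T then (2 : ℝ) ^ M else θ * (2 : ℝ) ^ M) := by
    rw [← htile]
    push_cast
    exact Finset.sum_le_sum fun u _ => hper u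
  rw [Finset.sum_ite, Finset.sum_const, Finset.sum_const, nsmul_eq_mul, nsmul_eq_mul] at hsum
  push_cast at hsum
  have htot : ((univ.filter fun u : Fin n → Bool => (cblk p S u).card ≤ T).card : ℝ)
      + ((univ.filter fun u : Fin n → Bool => ¬ (cblk p S u).card ≤ T).card : ℝ) = (2 : ℝ) ^ n := by
    have e := Finset.card_filter_add_card_filter_not (s := (univ : Finset (Fin n → Bool)))
      (fun u : Fin n → Bool => (cblk p S u).card ≤ T)
    rw [card_univ, Fintype.card_fun, Fintype.card_bool, Fintype.card_fin] at e
    exact_mod_cast e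
  have h2M : (0 : ℝ) < (2 : ℝ) ^ M := by positivity
  have hθ1 : 0 ≤ 1 - θ := by linarith
  set B : ℝ := ((univ.filter fun u : Fin n → Bool => (cblk p S u).card ≤ T).card : ℝ) with hB
  set G : ℝ := ((univ.filter fun u : Fin n → Bool => ¬ (cblk p S u).card ≤ T).card : ℝ) with hG
  set Wn : ℝ := ((univ.filter fun u : Fin n → Bool => ringWinU c D.strat u = true).card : ℝ) with hWn
  have hsum' : (2 : ℝ) ^ M * Wn ≤ (2 : ℝ) ^ M * (B + θ * G) := by
    have e : B * (2 : ℝ) ^ M + G * (θ * (2 : ℝ) ^ M) = (2 : ℝ) ^ M * (B + θ * G) := by ring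
    rw [← e]
    exact hsum
  have hW : Wn ≤ B + θ * G := le_of_mul_le_mul_left hsum' h2M
  have hGe : G = (2 : ℝ) ^ n - B := by linarith
  have hprod : (1 - θ) * B ≤ (1 - θ) * ((2 : ℝ) ^ n / 2) := mul_le_mul_of_nonneg_left hbad_le hθ1
  rw [hGe] at hW
  nlinarith [hW, hprod]

/-- ★★★ **THE BLOCK DIAL in the summit's format — aligned `p`-blocks.**  For `p ≢ 0 (mod 3)`: junta ⊕ linear-form data with juntas
`≤ log₂ n` whose forms are constant on every aligned block `{kp,…,kp+p−1}` (i.e. `a_g i` depends only on `⌊i/p⌋`; ranks up to `n/p`,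
full supports — outside both the span dial and the sparse dial) win on at most `θ·2ⁿ` inputs for all large `n`. -/
theorem alignedBlock_hard (p : ℕ) (hp3 : p % 3 = 1 ∨ p % 3 = 2) :
    ∃ θ : ℝ, θ < 1 ∧ ∃ n₀ : ℕ, ∀ n ≥ n₀, ∀ (c : ℕ) (D : JLinPeel.JLinData p n), (∀ g, (D.J g).card ≤ Nat.log 2 n) →
      (∀ g (i i' : Fin n), i.val / p = i'.val / p → D.a g i = D.a g i') →
      ((univ.filter fun u : Fin n → Bool => ringWinU c D.strat u = true).card : ℝ) ≤ θ * (2 : ℝ) ^ n := by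
  obtain ⟨θ, hθ, N₁, hmain⟩ := blockDial_hard p hp3
  have hp1 : 1 ≤ p := by omega
  obtain ⟨m₀, hm₀⟩ := DWalk.const_mul_logPow_le' (p * 2 ^ p * 5) 2
  refine ⟨θ, hθ, max m₀ (max 4 (p * 2 ^ p * (N₁ + 1))), ?_⟩
  intro n hn c D hJ hconst
  have hn₀ : m₀ ≤ n := le_trans (le_max_left _ _) hn
  have hn4 : 4 ≤ n := le_trans (le_trans (le_max_left _ _) (le_max_right _ _)) hn
  have hnN : p * 2 ^ p * (N₁ + 1) ≤ n := le_trans (le_trans (le_max_right _ _) (le_max_right _ _)) hn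
  have hlog := hm₀ n hn₀
  have hlog1 : 1 ≤ Nat.log 2 n := Nat.log_pos (by norm_num) (by omega)
  set M : ℕ := n / p with hM
  let S : Fin M → ℕ := fun k => k.val * p
  have hS : ((∀ k k', k < k' → S k + p ≤ S k') ∧ (∀ k, S k + p ≤ n)) := by
    refine ⟨fun k k' hkk => ?_, fun k => ?_⟩
    · show k.val * p + p ≤ k'.val * p
      have hlt : k.val + 1 ≤ k'.val := hkk
      nlinarith
    · show k.val * p + p ≤ n
      have hk : k.val + 1 ≤ n / p := k.isLt
      have := (Nat.le_div_iff_mul_le hp1).mp hk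
      nlinarith
  have hM₁ : 2 ^ p * (N₁ + 1) ≤ M := by
    refine (Nat.le_div_iff_mul_le hp1).mpr ?_
    calc 2 ^ p * (N₁ + 1) * p = p * 2 ^ p * (N₁ + 1) := by ring
      _ ≤ n := hnN
  have hM₂ : 2 ^ p * ((Nat.log 2 n + 1) * (Nat.log 2 n + 1) + 1) ≤ M := by
    refine (Nat.le_div_iff_mul_le hp1).mpr ?_
    have h5 : (Nat.log 2 n + 1) * (Nat.log 2 n + 1) + 1 ≤ 5 * Nat.log 2 n ^ 2 := by nlinarith [hlog1]
    calc 2 ^ p * ((Nat.log 2 n + 1) * (Nat.log 2 n + 1) + 1) * p ≤ 2 ^ p * (5 * Nat.log 2 n ^ 2) * p :=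
          Nat.mul_le_mul_right _ (Nat.mul_le_mul_left _ h5)
      _ = p * 2 ^ p * 5 * Nat.log 2 n ^ 2 := by ring
      _ ≤ n := hlog
  refine hmain n M (Nat.log 2 n) S hS hM₁ hM₂ c D hJ ?_
  intro g k i i' hi hi'
  apply hconst
  have hdiv : ∀ j : Fin n, (S k ≤ j.val ∧ j.val < S k + p) → j.val / p = k.val := by
    intro j hj
    have h1 : k.val ≤ j.val / p := (Nat.le_div_iff_mul_le hp1).mpr hj.1
    have h2 : j.val / p < k.val + 1 := by
      refine (Nat.div_lt_iff_lt_mul hp1).mpr ?_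
      have h' : j.val < k.val * p + p := hj.2
      rw [add_mul, one_mul]
      exact h'
    omega
  rw [hdiv i hi, hdiv i' hi']



-- (axiom guards of the annex dropped at landing; the gate records axioms)

end BlockTail

end Summit.QuantumAdvantage.AdviceFreeQNC0.JLinPeel.BlockDial
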